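import Summits.HodgeConjecture.HodgeConjecture.Theorems.WeilTypeLadderTargetTransfer
import Summits.HodgeConjecture.HodgeConjecture.Theorems.WeilTypeLadderCyclicPrymRealRoots
import Literature.AlgebraicGeometry.HodgeTheory.FermatHodgeConjectureProducts
import Mathlib.RingTheory.Polynomial.Cyclotomic.Roots
import Mathlib.RingTheory.Polynomial.Eisenstein.Basic
import Mathlib.Tactic.ComputeDegree
import HarnessLib

/-!
# WeilTypeLadder · R3 (`WeilClassesCMField`) for the CM subfield `K′ = ℚ(ζ_31)^{C_5} ⊂ ℚ(ζ_31)` of DEGREE SIX (`[K′:ℚ] = 6`, `[E:K′] = 5`):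
# minimal polynomial `T ^ 6 + 31 * T ^ 4 + 248 * T ^ 2 + 496` of `θ = η − η̄` (`η = ζ + ζ^2 + ζ^4 + ζ^8 + ζ^16`); the rung's eight arithmetic
# hypotheses DISCHARGED (Eisenstein at `31`; purely imaginary roots by the sign-change criterion for the cubic `P₀`; `Q = −T`;
# `P(φ) = 0 ⇐ Φ_31(s) = 0` by a chain in `ℤ[T]/(T^31 − 1)`); the transfer over the five-fold Fermat product `(Xʰ_31)^{⊗5}`

b2b cell `hweil` (packet `run/shared/lean/b2b/hodge-weil/`, report `b2b-hweil-pv3-g45/GENERIC-HODGE-GROUP.md` §9; on the cell lead's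
word, carver-g114: «open `hodgeClasses_algebraic_fermatProduct₅/₇/₉`, then place the s = 5 / 7 / 9 rows via COROLLARY R3-CYC′»). `E = ℚ(ζ_31)`,
`U ≅ ℤ/30`, `H′ = C_5 = {1, 2, 4, 8, 16}`, `K′ = E^{H′}` (CM of degree `6`; `K′⁺` real of degree `3`), `s = [E:K′] = 5`:
PROPOSITION CYC′ of [P3-g43] transfers the `K′`-Weil classes of the `ζ_31`-primitive Prym of a `ℤ/31`-cover of `ℙ¹` to `(Xʰ_31)^{⊗5}`
(`hodgeClasses_algebraic_fermatProduct₅`; `31` is prime — Shioda's range). Generator `θ := η − η̄` (`η` the Gaussian period of `H′`,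
`θ̄ = −θ`), minimal polynomial **`P = T ^ 6 + 31 * T ^ 4 + 248 * T ^ 2 + 496`** `= P₀(T²)`, `P₀ = u ^ 3 + 31 * u ^ 2 + 248 * u + 496` (Eisenstein at `31`; computed EXACTLY in
`ℤ[ζ_31]` by `code/pv3-g45/periods2.py` = [P3-g44]'s `periods.py` with `C₃` replaced by `C_s`). On `B` with `Φ_31(s) = 0`:
**`φ := s + s^2 + s^4 + s^8 + s^16 - s^15 - s^23 - s^27 - s^29 - s^30`**. `P(φ) = 0` by [P3-g44]'s device: work modulo `T^31 − 1`
— `s^31 = 1` follows from `Φ_31(s) = 0` (`geom_sum_mul`) —, with the powers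
`φ^k ≡ r̃_k` (`k ≤ 6`) reduced by EXPONENT ARITHMETIC only (`r̃_k·φ = r̃_{k+1} + (T^31 − 1)·w_k`, each a `ring` identity between
polynomials written COMPACTLY as `∑ i ∈ range 31, C (Lᵢ) T^i` from integer coefficient LISTS), and the final identity
`Σᵢ aᵢ r̃_{2i} + a₀ = 16·Φ_31(T)` EXACTLY (both sides of degree `< 31`; LEMMA AUG: the constant is `P(0)/31 = 16`).
Dimensions: `dim B = 15h`, `h = 2n`, classes `weilClassesField B φ P (10n) ⊂ H^{10n}(B)` (`hs = 5·2n`), `e·(2m) = 6·10n = 2·dim B = 2·30n`.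

What is PROVED here (kernel): (§1) `P` monic of degree `6`, irreducible over `ℚ` (Eisenstein + Gauss); `P₀` has `3` sign changes at
`u = -20, -19, -8, -3` (values `-64, 116, -16, 4`), hence only real roots
(`conj_eq_self_of_sign_changes` of `…CyclicPrymRealRoots`); so a complex root `ρ` of `P` has `ρ̄² = ρ²`, `ρ̄ ≠ ρ` (`P > 0` on `ℝ`),
`ρ̄ = −ρ`: «no real root» and `Q = −T`; the 5 chain identities and the final identity (`simp` expansion + `ring`); `P(φ) = 0`.
(§2) the R3 body over `(((X₁ ⊗ X₂) ⊗ X₃) ⊗ X₄) ⊗ X₅`, `Xᵢ = X^{2n}_31`, from the two refereed named facts; from the rung (HONEST SPECIALISATION at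
`(B, φ, P, 6, 5n)`, all eight hypotheses discharged); ON-PATH.

What is NOT in the kernel: the datum (PROPOSITION CYC′) and `K′`-Weil-ness (THEOREM W′); the census of the `K′`-Weil NON-`E`-Weil
families (report §9; `code/pv3-g45/kfam.py`). HONEST LABEL: sub-families, never the general member; 0 unconditional rungs above the floor; conditional on
[Shioda 1979 Thm. 2] + [Fulton 1998 Cor. 19.2 (b)] (refereed) and on the datum; Markman-free; the standing `weilClassesField`
identification flag applies. No `sorry`, no new definition, no new named fact.
-/

noncomputable section

-- every declaration of this problem lives in `Summit.HodgeConjecture.HodgeConjecture.…` (summit = sub-problem)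
set_option linter.dupNamespace false

open CategoryTheory MonoidalCategory Polynomial
open Literature.AlgebraicGeometry Literature.AlgebraicGeometry.Motives
open Literature.AlgebraicGeometry.HodgeTheory
open Literature.AlgebraicTopology.SingularHomology

namespace Summit.HodgeConjecture.HodgeConjecture.WeilTypeLadder

/-! ### §1 The sextic `T ^ 6 + 31 * T ^ 4 + 248 * T ^ 2 + 496`, the cubic `P₀`, and the chain modulo `T^31 − 1` -/

section Sextic

/-- `T ^ 6 + 31 * T ^ 4 + 248 * T ^ 2 + 496 ∈ ℤ[T]` is monic. [folklore] -/
theorem sexticThirtyOne_monic : (X ^ 6 + 31 * X ^ 4 + 248 * X ^ 2 + 496 : Polynomial ℤ).Monic := by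
  monicity!

/-- `T ^ 6 + 31 * T ^ 4 + 248 * T ^ 2 + 496` has degree `6`. [folklore] -/
theorem sexticThirtyOne_natDegree : (X ^ 6 + 31 * X ^ 4 + 248 * X ^ 2 + 496 : Polynomial ℤ).natDegree = 6 := by
  compute_degree!

/-- The coefficients of `T ^ 6 + 31 * T ^ 4 + 248 * T ^ 2 + 496` below the top one are divisible by `31`. [folklore] -/
theorem sexticThirtyOne_coeff_mem {n : ℕ} (hn : n < 6) :
    (X ^ 6 + 31 * X ^ 4 + 248 * X ^ 2 + 496 : Polynomial ℤ).coeff n ∈ Ideal.span {(31 : ℤ)} := by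
  rw [Ideal.mem_span_singleton]
  interval_cases n <;> simp [coeff_X_pow, coeff_ofNat_mul]

/-- `T ^ 6 + 31 * T ^ 4 + 248 * T ^ 2 + 496` is Eisenstein at `(31)`. [folklore] -/
theorem sexticThirtyOne_isEisensteinAt :
    (X ^ 6 + 31 * X ^ 4 + 248 * X ^ 2 + 496 : Polynomial ℤ).IsEisensteinAt (Ideal.span {(31 : ℤ)}) where
  leading := by
    rw [Polynomial.Monic.leadingCoeff sexticThirtyOne_monic, Ideal.mem_span_singleton]; norm_num
  mem := fun {n} hn => sexticThirtyOne_coeff_mem (by rwa [sexticThirtyOne_natDegree] at hn)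
  notMem := by
    rw [Ideal.span_singleton_pow, Ideal.mem_span_singleton]
    simp [coeff_X_pow, coeff_ofNat_mul]

/-- `T ^ 6 + 31 * T ^ 4 + 248 * T ^ 2 + 496` is irreducible over `ℚ` (Eisenstein at `31` over `ℤ`, then Gauss's lemma). [folklore] -/
theorem sexticThirtyOne_irreducible :
    Irreducible ((X ^ 6 + 31 * X ^ 4 + 248 * X ^ 2 + 496 : Polynomial ℤ).map (Int.castRingHom ℚ)) := by
  have hprime : (Ideal.span {(31 : ℤ)}).IsPrime :=
    (Ideal.span_singleton_prime (by norm_num)).mpr (Nat.prime_iff_prime_int.mp (by norm_num))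
  have hZ : Irreducible (X ^ 6 + 31 * X ^ 4 + 248 * X ^ 2 + 496 : Polynomial ℤ) :=
    sexticThirtyOne_isEisensteinAt.irreducible hprime sexticThirtyOne_monic.isPrimitive
      (by rw [sexticThirtyOne_natDegree]; norm_num)
  have := (Polynomial.IsPrimitive.irreducible_iff_irreducible_map_fraction_map (K := ℚ)
    sexticThirtyOne_monic.isPrimitive).1 hZ
  rwa [← algebraMap_int_eq]

/-- Evaluation of `T ^ 6 + 31 * T ^ 4 + 248 * T ^ 2 + 496` in any ring. -/
theorem eval₂_sexticThirtyOne {R : Type*} [Ring R] (x : R) :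
    Polynomial.eval₂ (Int.castRingHom R) x (X ^ 6 + 31 * X ^ 4 + 248 * X ^ 2 + 496 : Polynomial ℤ) =
      x ^ 6 + 31 * x ^ 4 + 248 * x ^ 2 + 496 := by
  rw [← algebraMap_int_eq, ← Polynomial.aeval_def]
  simp only [map_add, map_mul, map_pow, Polynomial.aeval_X, map_ofNat]

/-- For a complex root `ρ` of `T ^ 6 + 31 * T ^ 4 + 248 * T ^ 2 + 496`, `ρ²` is a root of the cubic
`P₀ = u ^ 3 + 31 * u ^ 2 + 248 * u + 496`, which has `3` consecutive sign changes at `u = -20, -19, -8, -3`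
(`P₀(u) = -64, 116, -16, 4`), hence only real roots (`conj_eq_self_of_sign_changes`): `ρ̄² = ρ²`. [folklore] -/
theorem conj_sq_eq_sq_of_sexticThirtyOne {ρ : ℂ} (hρ : ρ ^ 6 + 31 * ρ ^ 4 + 248 * ρ ^ 2 + 496 = 0) :
    starRingEnd ℂ (ρ ^ 2) = ρ ^ 2 := by
  refine conj_eq_self_of_sign_changes (X ^ 3 + 31 * X ^ 2 + 248 * X + 496 : Polynomial ℝ) 2 (by monicity!) (by compute_degree!)
    (fun i => (([-20, -19, -8, -3] : List ℝ).getD i 0)) (by intro i hi; interval_cases i <;> norm_num)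
    (by intro i hi; interval_cases i <;> norm_num) ?_
  simp only [map_add, map_mul, map_pow, Polynomial.aeval_X, map_ofNat]
  linear_combination hρ

/-- The complex roots of `T ^ 6 + 31 * T ^ 4 + 248 * T ^ 2 + 496` are NON-REAL (`P > 0` on `ℝ`): the rung's "no real root". [folklore] -/
theorem conj_ne_self_of_sexticThirtyOne {ρ : ℂ}
    (hρ : Polynomial.eval₂ (Int.castRingHom ℂ) ρ (X ^ 6 + 31 * X ^ 4 + 248 * X ^ 2 + 496 : Polynomial ℤ) = 0) :
    starRingEnd ℂ ρ ≠ ρ := by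
  rw [eval₂_sexticThirtyOne] at hρ
  intro hc
  have hre : ((ρ.re : ℝ) : ℂ) = ρ := Complex.conj_eq_iff_re.mp hc
  have hr : ((ρ.re ^ 6 + 31 * ρ.re ^ 4 + 248 * ρ.re ^ 2 + 496 : ℝ) : ℂ) = 0 := by push_cast; rw [hre]; exact hρ
  have hr' : ρ.re ^ 6 + 31 * ρ.re ^ 4 + 248 * ρ.re ^ 2 + 496 = 0 := by exact_mod_cast hr
  have hpos : 0 < ρ.re ^ 6 + 31 * ρ.re ^ 4 + 248 * ρ.re ^ 2 + 496 := by positivity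
  exact absurd hr' (ne_of_gt hpos)

/-- `Q = −T` carries every complex root of `T ^ 6 + 31 * T ^ 4 + 248 * T ^ 2 + 496` to its conjugate: the rung's "CM involution is a polynomial". [folklore] -/
theorem exists_conjPolynomial_sexticThirtyOne :
    ∃ Q : Polynomial ℚ, ∀ ρ : ℂ, Polynomial.eval₂ (Int.castRingHom ℂ) ρ (X ^ 6 + 31 * X ^ 4 + 248 * X ^ 2 + 496 : Polynomial ℤ) = 0 →
      Polynomial.eval₂ (algebraMap ℚ ℂ) ρ Q = starRingEnd ℂ ρ := by
  refine ⟨-Polynomial.X, fun ρ hρ => ?_⟩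
  have hne := conj_ne_self_of_sexticThirtyOne hρ
  rw [eval₂_sexticThirtyOne] at hρ
  rw [Polynomial.eval₂_neg, Polynomial.eval₂_X]
  exact (conj_eq_neg_of_conj_sq_eq (conj_sq_eq_sq_of_sexticThirtyOne hρ) hne).symm

/-- Chain modulo `T^31 − 1`, step 1: `φ·φ = r̃₂ + (T^31 − 1)·w₁` in `ℤ[T]` (`φ = X + X^2 + X^4 + X^8 + X^16 - X^15 - X^23 - X^27 - X^29 - X^30`; `r̃₂`, `w₁` from their integer coefficient lists; exponent arithmetic only). [folklore] -/
theorem sexticThirtyOne_step1 :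
    ((X + X ^ 2 + X ^ 4 + X ^ 8 + X ^ 16 - X ^ 15 - X ^ 23 - X ^ 27 - X ^ 29 - X ^ 30) * (X + X ^ 2 + X ^ 4 + X ^ 8 + X ^ 16 - X ^ 15 - X ^ 23 - X ^ 27 - X ^ 29 - X ^ 30) : Polynomial ℤ) =
      (∑ i ∈ Finset.range 31, C (([-10, -1, -1, 0, -1, 2, 0, 0, -1, 2, 2, 2, 0, 2, 0, -1, -1, 0, 2, 0, 2, 2, 2, -1, 0, 0, 2, -1, 0, -1, -1] : List ℤ).getD i 0) * X ^ i) +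
      (X ^ 31 - 1 : Polynomial ℤ) * (∑ i ∈ Finset.range 30, C (([-10, -1, -2, -2, -2, 0, -2, 0, -2, 0, 0, 2, -2, 2, 0, -1, 0, 0, 0, 2, 0, 2, 2, 1, 0, 2, 2, 1, 2, 1] : List ℤ).getD i 0) * X ^ i) := by
  simp [Finset.sum_range_succ]
  ring

/-- Chain modulo `T^31 − 1`, step 2: `r̃_2·φ = r̃_3 + (T^31 − 1)·w_2` (`r̃_3 ≡ φ^3`, coefficient lists). [folklore] -/
theorem sexticThirtyOne_step2 :
    (∑ i ∈ Finset.range 31, C (([-10, -1, -1, 0, -1, 2, 0, 0, -1, 2, 2, 2, 0, 2, 0, -1, -1, 0, 2, 0, 2, 2, 2, -1, 0, 0, 2, -1, 0, -1, -1] : List ℤ).getD i 0) * X ^ i) * (X + X ^ 2 + X ^ 4 + X ^ 8 + X ^ 16 - X ^ 15 - X ^ 23 - X ^ 27 - X ^ 29 - X ^ 30) =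
      (∑ i ∈ Finset.range 31, C (([0, -15, -15, -2, -15, -6, -2, 2, -15, -6, -6, 6, -2, 6, 2, 15, -15, -2, -6, 2, -6, 6, 6, 15, -2, 2, 6, 15, 2, 15, 15] : List ℤ).getD i 0) * X ^ i) +
      (X ^ 31 - 1 : Polynomial ℤ) * (∑ i ∈ Finset.range 30, C (([0, -5, -4, 0, -4, -4, -2, 0, -4, -6, -6, 2, -4, 0, -2, 1, -4, -4, -6, -2, -4, 0, 0, 1, -2, 0, 2, 1, 2, 1] : List ℤ).getD i 0) * X ^ i) := by
  simp [Finset.sum_range_succ]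
  ring

/-- Chain modulo `T^31 − 1`, step 3: `r̃_3·φ = r̃_4 + (T^31 − 1)·w_3` (`r̃_4 ≡ φ^4`, coefficient lists). [folklore] -/
theorem sexticThirtyOne_step3 :
    (∑ i ∈ Finset.range 31, C (([0, -15, -15, -2, -15, -6, -2, 2, -15, -6, -6, 6, -2, 6, 2, 15, -15, -2, -6, 2, -6, 6, 6, 15, -2, 2, 6, 15, 2, 15, 15] : List ℤ).getD i 0) * X ^ i) * (X + X ^ 2 + X ^ 4 + X ^ 8 + X ^ 16 - X ^ 15 - X ^ 23 - X ^ 27 - X ^ 29 - X ^ 30) =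
      (∑ i ∈ Finset.range 31, C (([150, 31, 31, -4, 31, -42, -4, -4, 31, -42, -42, -42, -4, -42, -4, 31, 31, -4, -42, -4, -42, -42, -42, 31, -4, -4, -42, 31, -4, 31, 31] : List ℤ).getD i 0) * X ^ i) +
      (X ^ 31 - 1 : Polynomial ℤ) * (∑ i ∈ Finset.range 30, C (([150, 31, 46, 26, 48, -10, 32, 6, 46, -8, -4, -30, 26, -34, 0, 15, 16, -4, -8, -30, -12, -38, -34, -15, -10, -36, -32, -17, -30, -15] : List ℤ).getD i 0) * X ^ i) := by
  simp [Finset.sum_range_succ]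
  ring

/-- Chain modulo `T^31 − 1`, step 4: `r̃_4·φ = r̃_5 + (T^31 − 1)·w_4` (`r̃_5 ≡ φ^5`, coefficient lists). [folklore] -/
theorem sexticThirtyOne_step4 :
    (∑ i ∈ Finset.range 31, C (([150, 31, 31, -4, 31, -42, -4, -4, 31, -42, -42, -42, -4, -42, -4, 31, 31, -4, -42, -4, -42, -42, -42, 31, -4, -4, -42, 31, -4, 31, 31] : List ℤ).getD i 0) * X ^ i) * (X + X ^ 2 + X ^ 4 + X ^ 8 + X ^ 16 - X ^ 15 - X ^ 23 - X ^ 27 - X ^ 29 - X ^ 30) =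
      (∑ i ∈ Finset.range 31, C (([0, 265, 265, 70, 265, 146, 70, -70, 265, 146, 146, -146, 70, -146, -70, -265, 265, 70, 146, -70, 146, -146, -146, -265, 70, -70, -146, -265, -70, -265, -265] : List ℤ).getD i 0) * X ^ i) +
      (X ^ 31 - 1 : Polynomial ℤ) * (∑ i ∈ Finset.range 30, C (([0, 115, 84, 8, 88, 88, 50, -20, 92, 130, 130, -54, 92, -16, 22, -23, 92, 92, 130, 22, 92, -16, -16, -23, 50, -20, -58, -27, -62, -31] : List ℤ).getD i 0) * X ^ i) := by
  simp [Finset.sum_range_succ]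
  ring

/-- Chain modulo `T^31 − 1`, step 5: `r̃_5·φ = r̃_6 + (T^31 − 1)·w_5` (`r̃_6 ≡ φ^6`, coefficient lists). [folklore] -/
theorem sexticThirtyOne_step5 :
    (∑ i ∈ Finset.range 31, C (([0, 265, 265, 70, 265, 146, 70, -70, 265, 146, 146, -146, 70, -146, -70, -265, 265, 70, 146, -70, 146, -146, -146, -265, 70, -70, -146, -265, -70, -265, -265] : List ℤ).getD i 0) * X ^ i) * (X + X ^ 2 + X ^ 4 + X ^ 8 + X ^ 16 - X ^ 15 - X ^ 23 - X ^ 27 - X ^ 29 - X ^ 30) =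
      (∑ i ∈ Finset.range 31, C (([-2650, -697, -697, 140, -697, 822, 140, 140, -697, 822, 822, 822, 140, 822, 140, -697, -697, 140, 822, 140, 822, 822, 822, -697, 140, 140, 822, -697, 140, -697, -697] : List ℤ).getD i 0) * X ^ i) +
      (X ^ 31 - 1 : Polynomial ℤ) * (∑ i ∈ Finset.range 30, C (([-2650, -697, -962, -390, -1032, 222, -536, -146, -962, 216, 76, 530, -390, 606, 0, -265, -432, 140, 216, 530, 292, 746, 606, 265, 286, 676, 600, 335, 530, 265] : List ℤ).getD i 0) * X ^ i) := by
  simp [Finset.sum_range_succ]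
  ring

/-- The final identity, EXACT in `ℤ[T]` (degrees `< 31`): `r̃_6 + 31·r̃_4 + 248·r̃_2 + 496 = 16·Φ_31(T) = 16·Σ_{i<31} Tⁱ` (the reduction of `P(φ)` modulo `T^31 − 1`
is `(P(0)/31)·Φ_31`; check at `T = 1`: `P(φ(1)) = P(0) = 496 = 16·Φ_31(1)`). [folklore] -/
theorem sexticThirtyOne_final :
    ((∑ i ∈ Finset.range 31, C (([-2650, -697, -697, 140, -697, 822, 140, 140, -697, 822, 822, 822, 140, 822, 140, -697, -697, 140, 822, 140, 822, 822, 822, -697, 140, 140, 822, -697, 140, -697, -697] : List ℤ).getD i 0) * X ^ i) +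
        31 * (∑ i ∈ Finset.range 31, C (([150, 31, 31, -4, 31, -42, -4, -4, 31, -42, -42, -42, -4, -42, -4, 31, 31, -4, -42, -4, -42, -42, -42, 31, -4, -4, -42, 31, -4, 31, 31] : List ℤ).getD i 0) * X ^ i) +
        248 * (∑ i ∈ Finset.range 31, C (([-10, -1, -1, 0, -1, 2, 0, 0, -1, 2, 2, 2, 0, 2, 0, -1, -1, 0, 2, 0, 2, 2, 2, -1, 0, 0, 2, -1, 0, -1, -1] : List ℤ).getD i 0) * X ^ i) +
        496 : Polynomial ℤ) =
      16 * ∑ i ∈ Finset.range 31, (X : Polynomial ℤ) ^ i := by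
  simp [Finset.sum_range_succ]
  ring

/-- `Φ_31(s) = 0 ⟹ P(s + s^2 + s^4 + s^8 + s^16 - s^15 - s^23 - s^27 - s^29 - s^30) = 0` in any ring, `P = T ^ 6 + 31 * T ^ 4 + 248 * T ^ 2 + 496`: `s^31 = 1` (`geom_sum_mul`), `y = φ(s)`,
`y^k = r̃_k(s)` for `k ≤ 6` by the chain, and `Σᵢ aᵢ r̃_{2i}(s) + a₀ = 16·Φ_31(s) = 0`. [folklore] -/
theorem eval₂_sexticThirtyOne_periodDiff {R : Type*} [Ring R] (s : R)
    (hs : Polynomial.eval₂ (Int.castRingHom R) s (Polynomial.cyclotomic 31 ℤ) = 0) :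
    Polynomial.eval₂ (Int.castRingHom R) (s + s ^ 2 + s ^ 4 + s ^ 8 + s ^ 16 - s ^ 15 - s ^ 23 - s ^ 27 - s ^ 29 - s ^ 30)
      (X ^ 6 + 31 * X ^ 4 + 248 * X ^ 2 + 496 : Polynomial ℤ) = 0 := by
  haveI : Fact (Nat.Prime 31) := ⟨by norm_num⟩
  rw [Polynomial.cyclotomic_prime, ← algebraMap_int_eq, ← Polynomial.aeval_def] at hs
  rw [eval₂_sexticThirtyOne]
  have hsum : (∑ i ∈ Finset.range 31, s ^ i) = 0 := by
    simpa only [map_sum, map_pow, Polynomial.aeval_X] using hs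
  have hsp : s ^ 31 = 1 := by rw [← sub_eq_zero, ← geom_sum_mul, hsum, zero_mul]
  have hXp : Polynomial.aeval s (X ^ 31 - 1 : Polynomial ℤ) = 0 := by
    rw [map_sub, map_pow, Polynomial.aeval_X, map_one, hsp, sub_self]
  generalize hφy : (s + s ^ 2 + s ^ 4 + s ^ 8 + s ^ 16 - s ^ 15 - s ^ 23 - s ^ 27 - s ^ 29 - s ^ 30 : R) = y
  have hy : y = Polynomial.aeval s ((X + X ^ 2 + X ^ 4 + X ^ 8 + X ^ 16 - X ^ 15 - X ^ 23 - X ^ 27 - X ^ 29 - X ^ 30) : Polynomial ℤ) := by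
    rw [← hφy]; simp only [map_add, map_sub, map_pow, Polynomial.aeval_X]
  have hy2 : y ^ 2 = Polynomial.aeval s (∑ i ∈ Finset.range 31, C (([-10, -1, -1, 0, -1, 2, 0, 0, -1, 2, 2, 2, 0, 2, 0, -1, -1, 0, 2, 0, 2, 2, 2, -1, 0, 0, 2, -1, 0, -1, -1] : List ℤ).getD i 0) * X ^ i) := by
    rw [pow_two, hy, ← map_mul, sexticThirtyOne_step1, map_add, map_mul, hXp, zero_mul, add_zero]
  have hy3 : y ^ 3 = Polynomial.aeval s (∑ i ∈ Finset.range 31, C (([0, -15, -15, -2, -15, -6, -2, 2, -15, -6, -6, 6, -2, 6, 2, 15, -15, -2, -6, 2, -6, 6, 6, 15, -2, 2, 6, 15, 2, 15, 15] : List ℤ).getD i 0) * X ^ i) := by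
    rw [show y ^ 3 = y ^ 2 * y from pow_succ y 2, hy2, hy, ← map_mul, sexticThirtyOne_step2, map_add, map_mul, hXp,
      zero_mul, add_zero]
  have hy4 : y ^ 4 = Polynomial.aeval s (∑ i ∈ Finset.range 31, C (([150, 31, 31, -4, 31, -42, -4, -4, 31, -42, -42, -42, -4, -42, -4, 31, 31, -4, -42, -4, -42, -42, -42, 31, -4, -4, -42, 31, -4, 31, 31] : List ℤ).getD i 0) * X ^ i) := by
    rw [show y ^ 4 = y ^ 3 * y from pow_succ y 3, hy3, hy, ← map_mul, sexticThirtyOne_step3, map_add, map_mul, hXp,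
      zero_mul, add_zero]
  have hy5 : y ^ 5 = Polynomial.aeval s (∑ i ∈ Finset.range 31, C (([0, 265, 265, 70, 265, 146, 70, -70, 265, 146, 146, -146, 70, -146, -70, -265, 265, 70, 146, -70, 146, -146, -146, -265, 70, -70, -146, -265, -70, -265, -265] : List ℤ).getD i 0) * X ^ i) := by
    rw [show y ^ 5 = y ^ 4 * y from pow_succ y 4, hy4, hy, ← map_mul, sexticThirtyOne_step4, map_add, map_mul, hXp,
      zero_mul, add_zero]
  have hy6 : y ^ 6 = Polynomial.aeval s (∑ i ∈ Finset.range 31, C (([-2650, -697, -697, 140, -697, 822, 140, 140, -697, 822, 822, 822, 140, 822, 140, -697, -697, 140, 822, 140, 822, 822, 822, -697, 140, 140, 822, -697, 140, -697, -697] : List ℤ).getD i 0) * X ^ i) := by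
    rw [show y ^ 6 = y ^ 5 * y from pow_succ y 5, hy5, hy, ← map_mul, sexticThirtyOne_step5, map_add, map_mul, hXp,
      zero_mul, add_zero]
  have hfin := congrArg (Polynomial.aeval s) sexticThirtyOne_final
  rw [map_mul, hs, mul_zero] at hfin
  simp only [map_add, map_mul, map_ofNat] at hfin
  rw [hy6, hy4, hy2]
  exact hfin

end Sextic

/-! ### §2 R3 for `K′ = ℚ(ζ_31)^{C_5} = ℚ(φ)` (degree `6`) on the `ζ_31`-primitive loci over the five-fold Fermat product `(Xʰ_31)^{⊗5}` -/

section ThirtyOneSextic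

/-- **R3 for the degree-6 field `K′ = ℚ(ζ_31)^{C_5}` on the `(Xʰ_31)^{⊗5}`-dominated `ζ_31`-locus, from the two named facts.** For an abelian
variety `B` with `s : B ⟶ B`, `Φ_31(s) = 0`, `dim B = 30n` (`h = 2n`), and a datum (`X₁, …, X₅` smooth projective Fermat varieties
`X^{2n}_31`, `T`, `a` surjective, `b : ι → (T ⟶ (((X₁ ⊗ X₂) ⊗ X₃) ⊗ X₄) ⊗ X₅)`), every class of `weilClassesField B φ P (10n)`
(`φ = s + s^2 + s^4 + s^8 + s^16 - s^15 - s^23 - s^27 - s^29 - s^30`, `P = T ^ 6 + 31 * T ^ 4 + 248 * T ^ 2 + 496`) whose pull-back lies in `⨆ᵢ (bᵢ)^*(span of the rational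
(5n,5n)-classes)` and which is rational of type `(5n,5n)` is algebraic.
[cite: Shioda1979PJA, §2 Thm. 2 (p. 112) with the list after Thm. 1] [cite: Fulton1998, §19.2 Cor. 19.2 (b)] [cite: MoonenZarhin1998WeilClasses, §1] -/
theorem weilClassesCMField_cyclicPrymThirtyOne_sextic_of_facts
    (hF₅ : hodgeClasses_algebraic_fermatProduct₅) (hP : fulton1998_map_mem_algebraicClasses) :
    ∀ (B : Motives.AbelianVariety ℂ) (s : B ⟶ B) (n : ℕ),
      Polynomial.eval₂ (Int.castRingHom (CategoryTheory.End B)) (s : CategoryTheory.End B)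
        (Polynomial.cyclotomic 31 ℤ) = 0 → B.dim = 30 * n →
    ∀ (X₁ X₂ X₃ X₄ X₅ T : Motives.SchemeOver ℂ),
      IsFermatVariety (2 * n) 31 X₁ → IsSmoothProjective (2 * n) X₁ →
      IsFermatVariety (2 * n) 31 X₂ → IsSmoothProjective (2 * n) X₂ →
      IsFermatVariety (2 * n) 31 X₃ → IsSmoothProjective (2 * n) X₃ →
      IsFermatVariety (2 * n) 31 X₄ → IsSmoothProjective (2 * n) X₄ →
      IsFermatVariety (2 * n) 31 X₅ → IsSmoothProjective (2 * n) X₅ →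
      IsSmoothProjective B.dim T →
    ∀ (a : T ⟶ B.X), AlgebraicGeometry.Surjective a.left → ∀ (ι : Type) (b : ι → (T ⟶ (((X₁ ⊗ X₂) ⊗ X₃) ⊗ X₄) ⊗ X₅)),
      ∀ c ∈ weilClassesField B
          (CategoryTheory.End.asHom (CategoryTheory.End.of s + CategoryTheory.End.of s ^ 2 + CategoryTheory.End.of s ^ 4 + CategoryTheory.End.of s ^ 8 + CategoryTheory.End.of s ^ 16 - CategoryTheory.End.of s ^ 15 - CategoryTheory.End.of s ^ 23 - CategoryTheory.End.of s ^ 27 - CategoryTheory.End.of s ^ 29 - CategoryTheory.End.of s ^ 30))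
          (X ^ 6 + 31 * X ^ 4 + 248 * X ^ 2 + 496 : Polynomial ℤ) (2 * (5 * n)),
        complexBetti.map a (2 * (5 * n)) c ∈ (⨆ i, (Submodule.span ℂ
            {x : complexBetti ((((X₁ ⊗ X₂) ⊗ X₃) ⊗ X₄) ⊗ X₅) (2 * (5 * n)) |
              IsRationalClass x ∧ IsOfHodgeType (2 * n + 2 * n + 2 * n + 2 * n + 2 * n) ((((X₁ ⊗ X₂) ⊗ X₃) ⊗ X₄) ⊗ X₅) (2 * (5 * n)) (5 * n) (5 * n) x}).map
              (complexBetti.map (b i) (2 * (5 * n))).hom) →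
        IsRationalClass c → IsOfHodgeType B.dim B.X (2 * (5 * n)) (5 * n) (5 * n) c → c ∈ algebraicClasses B.X (5 * n) := by
  intro B s n _ _ X₁ X₂ X₃ X₄ X₅ T hF₁' hX₁ hF₂' hX₂ hF₃' hX₃ hF₄' hX₄ hF₅' hX₅ hT a ha ι b c _ hc _ _
  exact abelianVariety_mem_algebraicClasses_of_targetTransferFamily hP B ((((hX₁.tensor_holds hX₂).tensor_holds hX₃).tensor_holds hX₄).tensor_holds hX₅)
    (span_rational_hodge_le_algebraicClasses_fermatProduct₅ hF₅ (Or.inl (by norm_num)) hF₁' hX₁ hF₂' hX₂ hF₃' hX₃ hF₄' hX₄ hF₅' hX₅ (5 * n))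
    hT a b hc

/-- **The same body from the rung R3 itself** — an HONEST SPECIALISATION at `(A, φ, P, e, m) := (B, φ, T ^ 6 + 31 * T ^ 4 + 248 * T ^ 2 + 496, 6, 5n)`:
`P` monic irreducible of degree `6 > 2` (Eisenstein at `31`), `P(φ) = 0` from `Φ_31(s) = 0`, `6·(2·5n) = 2·dim B`, roots non-real,
`Q = −T` — every arithmetic hypothesis DISCHARGED; the datum is not used. -/
theorem weilClassesCMField_cyclicPrymThirtyOne_sextic_of_weilClassesCMField (hR : WeilClassesCMField) :
    ∀ (B : Motives.AbelianVariety ℂ) (s : B ⟶ B) (n : ℕ),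
      Polynomial.eval₂ (Int.castRingHom (CategoryTheory.End B)) (s : CategoryTheory.End B)
        (Polynomial.cyclotomic 31 ℤ) = 0 → B.dim = 30 * n →
    ∀ (X₁ X₂ X₃ X₄ X₅ T : Motives.SchemeOver ℂ),
      IsFermatVariety (2 * n) 31 X₁ → IsSmoothProjective (2 * n) X₁ →
      IsFermatVariety (2 * n) 31 X₂ → IsSmoothProjective (2 * n) X₂ →
      IsFermatVariety (2 * n) 31 X₃ → IsSmoothProjective (2 * n) X₃ →
      IsFermatVariety (2 * n) 31 X₄ → IsSmoothProjective (2 * n) X₄ →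
      IsFermatVariety (2 * n) 31 X₅ → IsSmoothProjective (2 * n) X₅ →
      IsSmoothProjective B.dim T →
    ∀ (a : T ⟶ B.X), AlgebraicGeometry.Surjective a.left → ∀ (ι : Type) (b : ι → (T ⟶ (((X₁ ⊗ X₂) ⊗ X₃) ⊗ X₄) ⊗ X₅)),
      ∀ c ∈ weilClassesField B
          (CategoryTheory.End.asHom (CategoryTheory.End.of s + CategoryTheory.End.of s ^ 2 + CategoryTheory.End.of s ^ 4 + CategoryTheory.End.of s ^ 8 + CategoryTheory.End.of s ^ 16 - CategoryTheory.End.of s ^ 15 - CategoryTheory.End.of s ^ 23 - CategoryTheory.End.of s ^ 27 - CategoryTheory.End.of s ^ 29 - CategoryTheory.End.of s ^ 30))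
          (X ^ 6 + 31 * X ^ 4 + 248 * X ^ 2 + 496 : Polynomial ℤ) (2 * (5 * n)),
        complexBetti.map a (2 * (5 * n)) c ∈ (⨆ i, (Submodule.span ℂ
            {x : complexBetti ((((X₁ ⊗ X₂) ⊗ X₃) ⊗ X₄) ⊗ X₅) (2 * (5 * n)) |
              IsRationalClass x ∧ IsOfHodgeType (2 * n + 2 * n + 2 * n + 2 * n + 2 * n) ((((X₁ ⊗ X₂) ⊗ X₃) ⊗ X₄) ⊗ X₅) (2 * (5 * n)) (5 * n) (5 * n) x}).map
              (complexBetti.map (b i) (2 * (5 * n))).hom) →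
        IsRationalClass c → IsOfHodgeType B.dim B.X (2 * (5 * n)) (5 * n) (5 * n) c → c ∈ algebraicClasses B.X (5 * n) := by
  intro B s n hs hdim _ _ _ _ _ _ _ _ _ _ _ _ _ _ _ _ _ _ _ _ _ c hcW _ hc hmm
  have hφ : Polynomial.eval₂ (Int.castRingHom (CategoryTheory.End B))
      ((CategoryTheory.End.asHom (CategoryTheory.End.of s + CategoryTheory.End.of s ^ 2 + CategoryTheory.End.of s ^ 4 + CategoryTheory.End.of s ^ 8 + CategoryTheory.End.of s ^ 16 - CategoryTheory.End.of s ^ 15 - CategoryTheory.End.of s ^ 23 - CategoryTheory.End.of s ^ 27 - CategoryTheory.End.of s ^ 29 - CategoryTheory.End.of s ^ 30) : B ⟶ B) :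
        CategoryTheory.End B) (X ^ 6 + 31 * X ^ 4 + 248 * X ^ 2 + 496 : Polynomial ℤ) = 0 :=
    eval₂_sexticThirtyOne_periodDiff (CategoryTheory.End.of s) hs
  exact hR B _ (X ^ 6 + 31 * X ^ 4 + 248 * X ^ 2 + 496 : Polynomial ℤ) 6 (5 * n) sexticThirtyOne_monic
    sexticThirtyOne_natDegree (by norm_num) sexticThirtyOne_irreducible hφ (by omega)
    (fun ρ hρ => conj_ne_self_of_sexticThirtyOne hρ) exists_conjPolynomial_sexticThirtyOne c hcW hc hmm

/-- **On-path lemma**: `HodgeConjecture → WeilClassesCMField →` R3 for `ℚ(ζ_31)^{C_5}` on the `ζ_31`-locus. -/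
theorem weilClassesCMField_cyclicPrymThirtyOne_sextic_of_hodgeConjecture (hH : _root_.HodgeConjecture) :
    ∀ (B : Motives.AbelianVariety ℂ) (s : B ⟶ B) (n : ℕ),
      Polynomial.eval₂ (Int.castRingHom (CategoryTheory.End B)) (s : CategoryTheory.End B)
        (Polynomial.cyclotomic 31 ℤ) = 0 → B.dim = 30 * n →
    ∀ (X₁ X₂ X₃ X₄ X₅ T : Motives.SchemeOver ℂ),
      IsFermatVariety (2 * n) 31 X₁ → IsSmoothProjective (2 * n) X₁ →
      IsFermatVariety (2 * n) 31 X₂ → IsSmoothProjective (2 * n) X₂ →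
      IsFermatVariety (2 * n) 31 X₃ → IsSmoothProjective (2 * n) X₃ →
      IsFermatVariety (2 * n) 31 X₄ → IsSmoothProjective (2 * n) X₄ →
      IsFermatVariety (2 * n) 31 X₅ → IsSmoothProjective (2 * n) X₅ →
      IsSmoothProjective B.dim T →
    ∀ (a : T ⟶ B.X), AlgebraicGeometry.Surjective a.left → ∀ (ι : Type) (b : ι → (T ⟶ (((X₁ ⊗ X₂) ⊗ X₃) ⊗ X₄) ⊗ X₅)),
      ∀ c ∈ weilClassesField B
          (CategoryTheory.End.asHom (CategoryTheory.End.of s + CategoryTheory.End.of s ^ 2 + CategoryTheory.End.of s ^ 4 + CategoryTheory.End.of s ^ 8 + CategoryTheory.End.of s ^ 16 - CategoryTheory.End.of s ^ 15 - CategoryTheory.End.of s ^ 23 - CategoryTheory.End.of s ^ 27 - CategoryTheory.End.of s ^ 29 - CategoryTheory.End.of s ^ 30))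
          (X ^ 6 + 31 * X ^ 4 + 248 * X ^ 2 + 496 : Polynomial ℤ) (2 * (5 * n)),
        complexBetti.map a (2 * (5 * n)) c ∈ (⨆ i, (Submodule.span ℂ
            {x : complexBetti ((((X₁ ⊗ X₂) ⊗ X₃) ⊗ X₄) ⊗ X₅) (2 * (5 * n)) |
              IsRationalClass x ∧ IsOfHodgeType (2 * n + 2 * n + 2 * n + 2 * n + 2 * n) ((((X₁ ⊗ X₂) ⊗ X₃) ⊗ X₄) ⊗ X₅) (2 * (5 * n)) (5 * n) (5 * n) x}).map
              (complexBetti.map (b i) (2 * (5 * n))).hom) →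
        IsRationalClass c → IsOfHodgeType B.dim B.X (2 * (5 * n)) (5 * n) (5 * n) c → c ∈ algebraicClasses B.X (5 * n) :=
  weilClassesCMField_cyclicPrymThirtyOne_sextic_of_weilClassesCMField (weilClassesCMField_of_hodgeConjecture hH)

end ThirtyOneSextic

end Summit.HodgeConjecture.HodgeConjecture.WeilTypeLadder

end
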